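import Literature.Topology.FourManifolds.CappellShanesonClassGroupThirtyfour
import Literature.Topology.FourManifolds.CappellShanesonClassGroupThirtyfourCls
import Literature.Topology.FourManifolds.CappellShanesonTotallyReal
import Literature.Topology.FourManifolds.CappellShanesonClassGroupTwelve
import Literature.Topology.FourManifolds.CappellShanesonClassGroupFifteen
import HarnessLib

/-!
# Trace `34`: the class group, the cover of `C(ℤ[Θ₃₄])`, Gompf's conjecture for the traces `34` and `-29`

Part 'Main' of the certified class-group computation for the trace `34` field behind
Kim–Yamada's Theorem B (`GompfConjectureForTrace 34` and, by Theorem A, `-29`), serving the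
named fact
`Literature.Topology.FourManifolds.kimYamada2023_nonempty_diffeomorph_sphere_four_of_trace_mem_Icc`
(`CappellShaneson.lean`; M. H. Kim, S. Yamada, Kyungpook Math. J. 63 (2023) 373–411 =
arXiv:1707.03860, Cor. C). The computation is split over several files only because of the
proposal size limit: `…ClassGroupThirtyfour.lean` (discriminant, `𝓞 K = ℤ[θ]`, the primes of small norm), `…ClassGroupThirtyfourRel<k>.lean` (two-ideal relations with certified generators and the non-vanishing of the generators), `…ClassGroupThirtyfourCls.lean` (the class of every small prime in terms of the generator(s), the order relations), `…ClassGroupThirtyfourMain.lean` (generation of the class group by Minkowski's bound, the cover of `C(ℤ[Θ])` by standard-matrix representatives, Gompf's conjecture for the two traces). (File generated from a certified computation; every relation is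
checked by the Lean kernel; no named fact is introduced, D-0026.)

## References

* [KimYamada2023] M. H. Kim, S. Yamada, Kyungpook Math. J. 63 (2023) 373–411 (arXiv:1707.03860):
  §2.3 (Prop. 2.14), §6.1 (Lemma 6.1 and the proof of Thm. B), Thm. A.
* [Marcus2018] D. A. Marcus, *Number Fields*, 2nd ed., Ch. 3, Thm. 27 (Dedekind–Kummer); Ch. 5,
  Cor. 2 of Thm. 37 (Minkowski bound) and the class-group computations after it.
-/

noncomputable section

open Set Polynomial Module NumberField Ideal
open scoped NumberField MatrixGroups nonZeroDivisors
open Literature.LinearAlgebra.Matrix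

namespace Literature.Topology.FourManifolds

section Field

variable {K : Type*} [Field K] [NumberField K] {θ : K}

set_option maxHeartbeats 4000000 in
/-- **Every ideal class of the trace `34` field is `aʳbˢ`, `0 ≤ r < 2`, `0 ≤ s < 6`, for
`a = [(3, θ - 2)]`, `b = [(11, θ - 5)]`, represented by the ideals listed** (so the class number divides `12`).
Proof: `d_K = 978089`, `⌊M_K⌋ ≤ 219`, Dedekind–Kummer at `p ≤ 219`, the class of every small prime
computed above, and the relations `a²b⁴ = 1`, `b⁶ = 1`. [cite: KimYamada2023, §6.1 (proof of Thm. B)] -/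
theorem classGroup_mem_thirtyfour (hθ : aeval θ (csPoly 34) = 0) (h3 : finrank ℚ K = 3)
    (C : ClassGroup (𝓞 K)) :
    C = 1 ∨
      C = ClassGroup.mk0 ⟨span {(11 : 𝓞 K), thetaInt hθ - 5}, (span_pair_ofNat_mem_nonZeroDivisors (nat_lit 11) (thetaInt hθ - 5))⟩ ∨
      C = ClassGroup.mk0 ⟨span {(9 : 𝓞 K), thetaInt hθ - 2}, (span_pair_ofNat_mem_nonZeroDivisors (nat_lit 9) (thetaInt hθ - 2))⟩ ∨
      C = ClassGroup.mk0 ⟨span {(13 : 𝓞 K), thetaInt hθ - 9}, (span_pair_ofNat_mem_nonZeroDivisors (nat_lit 13) (thetaInt hθ - 9))⟩ ∨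
      C = ClassGroup.mk0 ⟨span {(7 : 𝓞 K), thetaInt hθ - 2}, (span_pair_ofNat_mem_nonZeroDivisors (nat_lit 7) (thetaInt hθ - 2))⟩ ∨
      C = ClassGroup.mk0 ⟨span {(19 : 𝓞 K), thetaInt hθ - 9}, (span_pair_ofNat_mem_nonZeroDivisors (nat_lit 19) (thetaInt hθ - 9))⟩ ∨
      C = ClassGroup.mk0 ⟨span {(3 : 𝓞 K), thetaInt hθ - 2}, (span_pair_ofNat_mem_nonZeroDivisors (nat_lit 3) (thetaInt hθ - 2))⟩ ∨
      C = ClassGroup.mk0 ⟨span {(19 : 𝓞 K), thetaInt hθ - 15}, (span_pair_ofNat_mem_nonZeroDivisors (nat_lit 19) (thetaInt hθ - 15))⟩ ∨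
      C = ClassGroup.mk0 ⟨span {(27 : 𝓞 K), thetaInt hθ - 20}, (span_pair_ofNat_mem_nonZeroDivisors (nat_lit 27) (thetaInt hθ - 20))⟩ ∨
      C = ClassGroup.mk0 ⟨span {(17 : 𝓞 K), thetaInt hθ - 5}, (span_pair_ofNat_mem_nonZeroDivisors (nat_lit 17) (thetaInt hθ - 5))⟩ ∨
      C = ClassGroup.mk0 ⟨span {(19 : 𝓞 K), thetaInt hθ - 10}, (span_pair_ofNat_mem_nonZeroDivisors (nat_lit 19) (thetaInt hθ - 10))⟩ ∨
      C = ClassGroup.mk0 ⟨span {(41 : 𝓞 K), thetaInt hθ - 26}, (span_pair_ofNat_mem_nonZeroDivisors (nat_lit 41) (thetaInt hθ - 26))⟩ := by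
  classical
  obtain ⟨a, ha⟩ : ∃ a : ClassGroup (𝓞 K), ClassGroup.mk0 ⟨span {(3 : 𝓞 K), thetaInt hθ - 2}, (span_pair_ofNat_mem_nonZeroDivisors (nat_lit 3) (thetaInt hθ - 2))⟩ = a := ⟨_, rfl⟩
  obtain ⟨b, hb⟩ : ∃ b : ClassGroup (𝓞 K), ClassGroup.mk0 ⟨span {(11 : 𝓞 K), thetaInt hθ - 5}, (span_pair_ofNat_mem_nonZeroDivisors (nat_lit 11) (thetaInt hθ - 5))⟩ = b := ⟨_, rfl⟩
  have hrow1 : a ^ (2 : ℤ) * b ^ (4 : ℤ) = 1 := by rw [← ha, ← hb]; exact row1_thirtyfour hθ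
  have hrow2 : b ^ (6 : ℤ) = 1 := by rw [← hb]; exact row2_thirtyfour hθ
  let H : Subgroup (ClassGroup (𝓞 K)) := Subgroup.zpowers a ⊔ Subgroup.zpowers b
  have hprinc : ∀ (P : Ideal (𝓞 K)) (hP0 : P ∈ (Ideal (𝓞 K))⁰) (x : 𝓞 K), P = span {x} →
      ClassGroup.mk0 ⟨P, hP0⟩ ∈ H := by
    intro P hP0 x hPx
    have : ClassGroup.mk0 ⟨P, hP0⟩ = 1 :=
      (ClassGroup.mk0_eq_one_iff hP0).mpr ⟨⟨x, by rw [hPx, submodule_span_eq]⟩⟩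
    rw [this]
    exact H.one_mem
  -- Minkowski: `⌊M_K⌋ ≤ 219`
  have hd : ((|NumberField.discr K| : ℤ) : ℝ) ≤ (978089 : ℕ) := by
    rw [discr_eq_thirtyfour hθ h3]
    norm_num
  have hfloor := floor_minkowskiBound_le_cubic_real h3 (nrComplexPlaces_eq_zero_of_csPoly hθ h3 (by norm_num))
    hd (s := 989) (U := 219) (by norm_num) (by norm_num) (by norm_num)
  have htop : H = ⊤ := by
    refine classGroup_subgroup_eq_top_of_primesOver H hfloor fun p hp hprime P hP0 hP hle => ?_
    have hpU : p ≤ 219 := (Finset.mem_Icc.mp hp).2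
    have h1p : 1 ≤ p := (Finset.mem_Icc.mp hp).1
    interval_cases p
    · exact absurd hprime (by norm_num)
    · exact hprinc P hP0 _ (eq_span_of_inert_thirtyfour hθ h3 (by norm_num) hP)
    · -- `p = 3`
      rcases eq_P3_or_eq_Q3_thirtyfour hθ h3 hP with h | h <;> subst h
      · rw [show ClassGroup.mk0 ⟨_, hP0⟩ = ClassGroup.mk0 ⟨span {(3 : 𝓞 K), thetaInt hθ - 2}, (span_pair_ofNat_mem_nonZeroDivisors (nat_lit 3) (thetaInt hθ - 2))⟩ from rfl, ha]
        exact Subgroup.mem_sup_left (Subgroup.mem_zpowers a)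
      · exact mem_zpowers_sup_of_mk0_eq a b (cls_Q3_thirtyfour hθ) ha hb
    · exact absurd hprime (by norm_num)
    · exact hprinc P hP0 _ (eq_span_of_inert_thirtyfour hθ h3 (by norm_num) hP)
    · exact absurd hprime (by norm_num)
    · -- `p = 7` (ramified)
      rcases eq_P7_thirtyfour hθ h3 hP with h | h | h <;> subst h
      · exact mem_zpowers_sup_of_mk0_eq a b (cls_P7_2_thirtyfour hθ) ha hb
      · exact mem_zpowers_sup_of_mk0_eq a b (cls_P7_2_thirtyfour hθ) ha hb
      · exact mem_zpowers_sup_of_mk0_eq a b (cls_P7_2_thirtyfour hθ) ha hb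
    · exact absurd hprime (by norm_num)
    · exact absurd hprime (by norm_num)
    · exact absurd hprime (by norm_num)
    · -- `p = 11`
      rcases eq_P11_or_eq_Q11_thirtyfour hθ h3 hP with h | h <;> subst h
      · rw [show ClassGroup.mk0 ⟨_, hP0⟩ = ClassGroup.mk0 ⟨span {(11 : 𝓞 K), thetaInt hθ - 5}, (span_pair_ofNat_mem_nonZeroDivisors (nat_lit 11) (thetaInt hθ - 5))⟩ from rfl, hb]
        exact Subgroup.mem_sup_right (Subgroup.mem_zpowers b)
      · exact mem_zpowers_sup_of_mk0_eq a b (cls_Q11_thirtyfour hθ) ha hb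
    · exact absurd hprime (by norm_num)
    · -- `p = 13`
      rcases eq_P13_or_eq_Q13_thirtyfour hθ h3 hP with h | h <;> subst h
      · exact mem_zpowers_sup_of_mk0_eq a b (cls_P13_9_thirtyfour hθ) ha hb
      · exact mem_zpowers_sup_of_mk0_eq a b (cls_Q13_thirtyfour hθ) ha hb
    · exact absurd hprime (by norm_num)
    · exact absurd hprime (by norm_num)
    · exact absurd hprime (by norm_num)
    · -- `p = 17`
      have h := eq_span_pair_of_unique_root_thirtyfour hθ h3 (Or.inl ⟨rfl, rfl⟩) hP hle
      simp only [Nat.cast_ofNat, Int.cast_ofNat] at h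
      subst h
      exact mem_zpowers_sup_of_mk0_eq a b (cls_P17_5_thirtyfour hθ) ha hb
    · exact absurd hprime (by norm_num)
    · -- `p = 19` (splits)
      rcases eq_P19_thirtyfour hθ h3 hP with h | h | h <;> subst h
      · exact mem_zpowers_sup_of_mk0_eq a b (cls_P19_9_thirtyfour hθ) ha hb
      · exact mem_zpowers_sup_of_mk0_eq a b (cls_P19_10_thirtyfour hθ) ha hb
      · exact mem_zpowers_sup_of_mk0_eq a b (cls_P19_15_thirtyfour hθ) ha hb
    · exact absurd hprime (by norm_num)
    · exact absurd hprime (by norm_num)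
    · exact absurd hprime (by norm_num)
    · -- `p = 23`
      have h := eq_span_pair_of_unique_root_thirtyfour hθ h3 (Or.inr (Or.inl ⟨rfl, rfl⟩)) hP hle
      simp only [Nat.cast_ofNat, Int.cast_ofNat] at h
      subst h
      exact mem_zpowers_sup_of_mk0_eq a b (cls_P23_22_thirtyfour hθ) ha hb
    · exact absurd hprime (by norm_num)
    · exact absurd hprime (by norm_num)
    · exact absurd hprime (by norm_num)
    · exact absurd hprime (by norm_num)
    · exact absurd hprime (by norm_num)
    · exact hprinc P hP0 _ (eq_span_of_inert_thirtyfour hθ h3 (by norm_num) hP)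
    · exact absurd hprime (by norm_num)
    · exact hprinc P hP0 _ (eq_span_of_inert_thirtyfour hθ h3 (by norm_num) hP)
    · exact absurd hprime (by norm_num)
    · exact absurd hprime (by norm_num)
    · exact absurd hprime (by norm_num)
    · exact absurd hprime (by norm_num)
    · exact absurd hprime (by norm_num)
    · -- `p = 37`
      have h := eq_span_pair_of_unique_root_thirtyfour hθ h3 (Or.inr (Or.inr (Or.inl ⟨rfl, rfl⟩))) hP hle
      simp only [Nat.cast_ofNat, Int.cast_ofNat] at h
      subst h
      exact mem_zpowers_sup_of_mk0_eq a b (cls_P37_26_thirtyfour hθ) ha hb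
    · exact absurd hprime (by norm_num)
    · exact absurd hprime (by norm_num)
    · exact absurd hprime (by norm_num)
    · -- `p = 41`
      have h := eq_span_pair_of_unique_root_thirtyfour hθ h3 (Or.inr (Or.inr (Or.inr (Or.inl ⟨rfl, rfl⟩)))) hP hle
      simp only [Nat.cast_ofNat, Int.cast_ofNat] at h
      subst h
      exact mem_zpowers_sup_of_mk0_eq a b (cls_P41_26_thirtyfour hθ) ha hb
    · exact absurd hprime (by norm_num)
    · exact hprinc P hP0 _ (eq_span_of_inert_thirtyfour hθ h3 (by norm_num) hP)
    · exact absurd hprime (by norm_num)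
    · exact absurd hprime (by norm_num)
    · exact absurd hprime (by norm_num)
    · -- `p = 47`
      have h := eq_span_pair_of_unique_root_thirtyfour hθ h3 (Or.inr (Or.inr (Or.inr (Or.inr (Or.inl ⟨rfl, rfl⟩))))) hP hle
      simp only [Nat.cast_ofNat, Int.cast_ofNat] at h
      subst h
      exact mem_zpowers_sup_of_mk0_eq a b (cls_P47_12_thirtyfour hθ) ha hb
    · exact absurd hprime (by norm_num)
    · exact absurd hprime (by norm_num)
    · exact absurd hprime (by norm_num)
    · exact absurd hprime (by norm_num)
    · exact absurd hprime (by norm_num)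
    · -- `p = 53`
      have h := eq_span_pair_of_unique_root_thirtyfour hθ h3 (Or.inr (Or.inr (Or.inr (Or.inr (Or.inr (Or.inl ⟨rfl, rfl⟩)))))) hP hle
      simp only [Nat.cast_ofNat, Int.cast_ofNat] at h
      subst h
      exact mem_zpowers_sup_of_mk0_eq a b (cls_P53_16_thirtyfour hθ) ha hb
    · exact absurd hprime (by norm_num)
    · exact absurd hprime (by norm_num)
    · exact absurd hprime (by norm_num)
    · exact absurd hprime (by norm_num)
    · exact absurd hprime (by norm_num)
    · -- `p = 59` (splits)
      rcases eq_P59_thirtyfour hθ h3 hP with h | h | h <;> subst h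
      · exact mem_zpowers_sup_of_mk0_eq a b (cls_P59_12_thirtyfour hθ) ha hb
      · exact mem_zpowers_sup_of_mk0_eq a b (cls_P59_34_thirtyfour hθ) ha hb
      · exact mem_zpowers_sup_of_mk0_eq a b (cls_P59_47_thirtyfour hθ) ha hb
    · exact absurd hprime (by norm_num)
    · -- `p = 61` (splits)
      rcases eq_P61_thirtyfour hθ h3 hP with h | h | h <;> subst h
      · exact mem_zpowers_sup_of_mk0_eq a b (cls_P61_20_thirtyfour hθ) ha hb
      · exact mem_zpowers_sup_of_mk0_eq a b (cls_P61_35_thirtyfour hθ) ha hb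
      · exact mem_zpowers_sup_of_mk0_eq a b (cls_P61_40_thirtyfour hθ) ha hb
    · exact absurd hprime (by norm_num)
    · exact absurd hprime (by norm_num)
    · exact absurd hprime (by norm_num)
    · exact absurd hprime (by norm_num)
    · exact absurd hprime (by norm_num)
    · exact hprinc P hP0 _ (eq_span_of_inert_thirtyfour hθ h3 (by norm_num) hP)
    · exact absurd hprime (by norm_num)
    · exact absurd hprime (by norm_num)
    · exact absurd hprime (by norm_num)
    · -- `p = 71` (splits)
      rcases eq_P71_thirtyfour hθ h3 hP with h | h | h <;> subst h
      · exact mem_zpowers_sup_of_mk0_eq a b (cls_P71_21_thirtyfour hθ) ha hb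
      · exact mem_zpowers_sup_of_mk0_eq a b (cls_P71_38_thirtyfour hθ) ha hb
      · exact mem_zpowers_sup_of_mk0_eq a b (cls_P71_46_thirtyfour hθ) ha hb
    · exact absurd hprime (by norm_num)
    · exact hprinc P hP0 _ (eq_span_of_inert_thirtyfour hθ h3 (by norm_num) hP)
    · exact absurd hprime (by norm_num)
    · exact absurd hprime (by norm_num)
    · exact absurd hprime (by norm_num)
    · exact absurd hprime (by norm_num)
    · exact absurd hprime (by norm_num)
    · -- `p = 79`
      have h := eq_span_pair_of_unique_root_thirtyfour hθ h3 (Or.inr (Or.inr (Or.inr (Or.inr (Or.inr (Or.inr (Or.inl ⟨rfl, rfl⟩))))))) hP hle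
      simp only [Nat.cast_ofNat, Int.cast_ofNat] at h
      subst h
      exact mem_zpowers_sup_of_mk0_eq a b (cls_P79_51_thirtyfour hθ) ha hb
    · exact absurd hprime (by norm_num)
    · exact absurd hprime (by norm_num)
    · exact absurd hprime (by norm_num)
    · -- `p = 83` (splits)
      rcases eq_P83_thirtyfour hθ h3 hP with h | h | h <;> subst h
      · exact mem_zpowers_sup_of_mk0_eq a b (cls_P83_51_thirtyfour hθ) ha hb
      · exact mem_zpowers_sup_of_mk0_eq a b (cls_P83_73_thirtyfour hθ) ha hb
      · exact mem_zpowers_sup_of_mk0_eq a b (cls_P83_76_thirtyfour hθ) ha hb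
    · exact absurd hprime (by norm_num)
    · exact absurd hprime (by norm_num)
    · exact absurd hprime (by norm_num)
    · exact absurd hprime (by norm_num)
    · exact absurd hprime (by norm_num)
    · exact hprinc P hP0 _ (eq_span_of_inert_thirtyfour hθ h3 (by norm_num) hP)
    · exact absurd hprime (by norm_num)
    · exact absurd hprime (by norm_num)
    · exact absurd hprime (by norm_num)
    · exact absurd hprime (by norm_num)
    · exact absurd hprime (by norm_num)
    · exact absurd hprime (by norm_num)
    · exact absurd hprime (by norm_num)
    · -- `p = 97`
      have h := eq_span_pair_of_unique_root_thirtyfour hθ h3 (Or.inr (Or.inr (Or.inr (Or.inr (Or.inr (Or.inr (Or.inr (Or.inl ⟨rfl, rfl⟩)))))))) hP hle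
      simp only [Nat.cast_ofNat, Int.cast_ofNat] at h
      subst h
      exact mem_zpowers_sup_of_mk0_eq a b (cls_P97_71_thirtyfour hθ) ha hb
    · exact absurd hprime (by norm_num)
    · exact absurd hprime (by norm_num)
    · exact absurd hprime (by norm_num)
    · exact hprinc P hP0 _ (eq_span_of_inert_thirtyfour hθ h3 (by norm_num) hP)
    · exact absurd hprime (by norm_num)
    · exact hprinc P hP0 _ (eq_span_of_inert_thirtyfour hθ h3 (by norm_num) hP)
    · exact absurd hprime (by norm_num)
    · exact absurd hprime (by norm_num)
    · exact absurd hprime (by norm_num)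
    · -- `p = 107`
      have h := eq_span_pair_of_unique_root_thirtyfour hθ h3 (Or.inr (Or.inr (Or.inr (Or.inr (Or.inr (Or.inr (Or.inr (Or.inr (Or.inl ⟨rfl, rfl⟩))))))))) hP hle
      simp only [Nat.cast_ofNat, Int.cast_ofNat] at h
      subst h
      exact mem_zpowers_sup_of_mk0_eq a b (cls_P107_90_thirtyfour hθ) ha hb
    · exact absurd hprime (by norm_num)
    · -- `p = 109`
      have h := eq_span_pair_of_unique_root_thirtyfour hθ h3 (Or.inr (Or.inr (Or.inr (Or.inr (Or.inr (Or.inr (Or.inr (Or.inr (Or.inr (Or.inl ⟨rfl, rfl⟩)))))))))) hP hle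
      simp only [Nat.cast_ofNat, Int.cast_ofNat] at h
      subst h
      exact mem_zpowers_sup_of_mk0_eq a b (cls_P109_10_thirtyfour hθ) ha hb
    · exact absurd hprime (by norm_num)
    · exact absurd hprime (by norm_num)
    · exact absurd hprime (by norm_num)
    · -- `p = 113`
      have h := eq_span_pair_of_unique_root_thirtyfour hθ h3 (Or.inr (Or.inr (Or.inr (Or.inr (Or.inr (Or.inr (Or.inr (Or.inr (Or.inr (Or.inr (Or.inl ⟨rfl, rfl⟩))))))))))) hP hle
      simp only [Nat.cast_ofNat, Int.cast_ofNat] at h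
      subst h
      exact mem_zpowers_sup_of_mk0_eq a b (cls_P113_93_thirtyfour hθ) ha hb
    · exact absurd hprime (by norm_num)
    · exact absurd hprime (by norm_num)
    · exact absurd hprime (by norm_num)
    · exact absurd hprime (by norm_num)
    · exact absurd hprime (by norm_num)
    · exact absurd hprime (by norm_num)
    · exact absurd hprime (by norm_num)
    · exact absurd hprime (by norm_num)
    · exact absurd hprime (by norm_num)
    · exact absurd hprime (by norm_num)
    · exact absurd hprime (by norm_num)
    · exact absurd hprime (by norm_num)
    · exact absurd hprime (by norm_num)
    · exact hprinc P hP0 _ (eq_span_of_inert_thirtyfour hθ h3 (by norm_num) hP)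
    · exact absurd hprime (by norm_num)
    · exact absurd hprime (by norm_num)
    · exact absurd hprime (by norm_num)
    · exact hprinc P hP0 _ (eq_span_of_inert_thirtyfour hθ h3 (by norm_num) hP)
    · exact absurd hprime (by norm_num)
    · exact absurd hprime (by norm_num)
    · exact absurd hprime (by norm_num)
    · exact absurd hprime (by norm_num)
    · exact absurd hprime (by norm_num)
    · -- `p = 137`
      have h := eq_span_pair_of_unique_root_thirtyfour hθ h3 (Or.inr (Or.inr (Or.inr (Or.inr (Or.inr (Or.inr (Or.inr (Or.inr (Or.inr (Or.inr (Or.inr (Or.inl ⟨rfl, rfl⟩)))))))))))) hP hle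
      simp only [Nat.cast_ofNat, Int.cast_ofNat] at h
      subst h
      exact mem_zpowers_sup_of_mk0_eq a b (cls_P137_48_thirtyfour hθ) ha hb
    · exact absurd hprime (by norm_num)
    · -- `p = 139`
      have h := eq_span_pair_of_unique_root_thirtyfour hθ h3 (Or.inr (Or.inr (Or.inr (Or.inr (Or.inr (Or.inr (Or.inr (Or.inr (Or.inr (Or.inr (Or.inr (Or.inr (Or.inl ⟨rfl, rfl⟩))))))))))))) hP hle
      simp only [Nat.cast_ofNat, Int.cast_ofNat] at h
      subst h
      exact mem_zpowers_sup_of_mk0_eq a b (cls_P139_101_thirtyfour hθ) ha hb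
    · exact absurd hprime (by norm_num)
    · exact absurd hprime (by norm_num)
    · exact absurd hprime (by norm_num)
    · exact absurd hprime (by norm_num)
    · exact absurd hprime (by norm_num)
    · exact absurd hprime (by norm_num)
    · exact absurd hprime (by norm_num)
    · exact absurd hprime (by norm_num)
    · exact absurd hprime (by norm_num)
    · -- `p = 149` (splits)
      rcases eq_P149_thirtyfour hθ h3 hP with h | h | h <;> subst h
      · exact mem_zpowers_sup_of_mk0_eq a b (cls_P149_73_thirtyfour hθ) ha hb
      · exact mem_zpowers_sup_of_mk0_eq a b (cls_P149_116_thirtyfour hθ) ha hb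
      · exact mem_zpowers_sup_of_mk0_eq a b (cls_P149_143_thirtyfour hθ) ha hb
    · exact absurd hprime (by norm_num)
    · exact hprinc P hP0 _ (eq_span_of_inert_thirtyfour hθ h3 (by norm_num) hP)
    · exact absurd hprime (by norm_num)
    · exact absurd hprime (by norm_num)
    · exact absurd hprime (by norm_num)
    · exact absurd hprime (by norm_num)
    · exact absurd hprime (by norm_num)
    · -- `p = 157`
      have h := eq_span_pair_of_unique_root_thirtyfour hθ h3 (Or.inr (Or.inr (Or.inr (Or.inr (Or.inr (Or.inr (Or.inr (Or.inr (Or.inr (Or.inr (Or.inr (Or.inr (Or.inr (Or.inl ⟨rfl, rfl⟩)))))))))))))) hP hle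
      simp only [Nat.cast_ofNat, Int.cast_ofNat] at h
      subst h
      exact mem_zpowers_sup_of_mk0_eq a b (cls_P157_146_thirtyfour hθ) ha hb
    · exact absurd hprime (by norm_num)
    · exact absurd hprime (by norm_num)
    · exact absurd hprime (by norm_num)
    · exact absurd hprime (by norm_num)
    · exact absurd hprime (by norm_num)
    · -- `p = 163`
      have h := eq_span_pair_of_unique_root_thirtyfour hθ h3 (Or.inr (Or.inr (Or.inr (Or.inr (Or.inr (Or.inr (Or.inr (Or.inr (Or.inr (Or.inr (Or.inr (Or.inr (Or.inr (Or.inr (Or.inl ⟨rfl, rfl⟩))))))))))))))) hP hle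
      simp only [Nat.cast_ofNat, Int.cast_ofNat] at h
      subst h
      exact mem_zpowers_sup_of_mk0_eq a b (cls_P163_158_thirtyfour hθ) ha hb
    · exact absurd hprime (by norm_num)
    · exact absurd hprime (by norm_num)
    · exact absurd hprime (by norm_num)
    · -- `p = 167` (splits)
      rcases eq_P167_thirtyfour hθ h3 hP with h | h | h <;> subst h
      · exact hprinc _ hP0 _ (P167_112_eq_thirtyfour hθ)
      · exact mem_zpowers_sup_of_mk0_eq a b (cls_P167_118_thirtyfour hθ) ha hb
      · exact mem_zpowers_sup_of_mk0_eq a b (cls_P167_138_thirtyfour hθ) ha hb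
    · exact absurd hprime (by norm_num)
    · exact absurd hprime (by norm_num)
    · exact absurd hprime (by norm_num)
    · exact absurd hprime (by norm_num)
    · exact absurd hprime (by norm_num)
    · -- `p = 173`
      have h := eq_span_pair_of_unique_root_thirtyfour hθ h3 (Or.inr (Or.inr (Or.inr (Or.inr (Or.inr (Or.inr (Or.inr (Or.inr (Or.inr (Or.inr (Or.inr (Or.inr (Or.inr (Or.inr (Or.inr (Or.inl ⟨rfl, rfl⟩)))))))))))))))) hP hle
      simp only [Nat.cast_ofNat, Int.cast_ofNat] at h
      subst h
      exact mem_zpowers_sup_of_mk0_eq a b (cls_P173_70_thirtyfour hθ) ha hb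
    · exact absurd hprime (by norm_num)
    · exact absurd hprime (by norm_num)
    · exact absurd hprime (by norm_num)
    · exact absurd hprime (by norm_num)
    · exact absurd hprime (by norm_num)
    · -- `p = 179`
      have h := eq_span_pair_of_unique_root_thirtyfour hθ h3 (Or.inr (Or.inr (Or.inr (Or.inr (Or.inr (Or.inr (Or.inr (Or.inr (Or.inr (Or.inr (Or.inr (Or.inr (Or.inr (Or.inr (Or.inr (Or.inr (Or.inl ⟨rfl, rfl⟩))))))))))))))))) hP hle
      simp only [Nat.cast_ofNat, Int.cast_ofNat] at h
      subst h
      exact mem_zpowers_sup_of_mk0_eq a b (cls_P179_40_thirtyfour hθ) ha hb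
    · exact absurd hprime (by norm_num)
    · -- `p = 181`
      have h := eq_span_pair_of_unique_root_thirtyfour hθ h3 (Or.inr (Or.inr (Or.inr (Or.inr (Or.inr (Or.inr (Or.inr (Or.inr (Or.inr (Or.inr (Or.inr (Or.inr (Or.inr (Or.inr (Or.inr (Or.inr (Or.inr (Or.inl ⟨rfl, rfl⟩)))))))))))))))))) hP hle
      simp only [Nat.cast_ofNat, Int.cast_ofNat] at h
      subst h
      exact hprinc _ hP0 _ (P181_3_eq_thirtyfour hθ)
    · exact absurd hprime (by norm_num)
    · exact absurd hprime (by norm_num)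
    · exact absurd hprime (by norm_num)
    · exact absurd hprime (by norm_num)
    · exact absurd hprime (by norm_num)
    · exact absurd hprime (by norm_num)
    · exact absurd hprime (by norm_num)
    · exact absurd hprime (by norm_num)
    · exact absurd hprime (by norm_num)
    · exact hprinc P hP0 _ (eq_span_of_inert_thirtyfour hθ h3 (by norm_num) hP)
    · exact absurd hprime (by norm_num)
    · -- `p = 193`
      have h := eq_span_pair_of_unique_root_thirtyfour hθ h3 (Or.inr (Or.inr (Or.inr (Or.inr (Or.inr (Or.inr (Or.inr (Or.inr (Or.inr (Or.inr (Or.inr (Or.inr (Or.inr (Or.inr (Or.inr (Or.inr (Or.inr (Or.inr (Or.inl ⟨rfl, rfl⟩))))))))))))))))))) hP hle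
      simp only [Nat.cast_ofNat, Int.cast_ofNat] at h
      subst h
      exact mem_zpowers_sup_of_mk0_eq a b (cls_P193_67_thirtyfour hθ) ha hb
    · exact absurd hprime (by norm_num)
    · exact absurd hprime (by norm_num)
    · exact absurd hprime (by norm_num)
    · -- `p = 197` (splits)
      rcases eq_P197_thirtyfour hθ h3 hP with h | h | h <;> subst h
      · exact hprinc _ hP0 _ (P197_100_eq_thirtyfour hθ)
      · exact mem_zpowers_sup_of_mk0_eq a b (cls_P197_151_thirtyfour hθ) ha hb
      · exact mem_zpowers_sup_of_mk0_eq a b (cls_P197_177_thirtyfour hθ) ha hb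
    · exact absurd hprime (by norm_num)
    · -- `p = 199` (splits)
      rcases eq_P199_thirtyfour hθ h3 hP with h | h | h <;> subst h
      · exact mem_zpowers_sup_of_mk0_eq a b (cls_P199_15_thirtyfour hθ) ha hb
      · exact mem_zpowers_sup_of_mk0_eq a b (cls_P199_28_thirtyfour hθ) ha hb
      · exact mem_zpowers_sup_of_mk0_eq a b (cls_P199_190_thirtyfour hθ) ha hb
    · exact absurd hprime (by norm_num)
    · exact absurd hprime (by norm_num)
    · exact absurd hprime (by norm_num)
    · exact absurd hprime (by norm_num)
    · exact absurd hprime (by norm_num)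
    · exact absurd hprime (by norm_num)
    · exact absurd hprime (by norm_num)
    · exact absurd hprime (by norm_num)
    · exact absurd hprime (by norm_num)
    · exact absurd hprime (by norm_num)
    · exact absurd hprime (by norm_num)
    · -- `p = 211`
      have h := eq_span_pair_of_unique_root_thirtyfour hθ h3 (Or.inr (Or.inr (Or.inr (Or.inr (Or.inr (Or.inr (Or.inr (Or.inr (Or.inr (Or.inr (Or.inr (Or.inr (Or.inr (Or.inr (Or.inr (Or.inr (Or.inr (Or.inr (Or.inr (⟨rfl, rfl⟩)))))))))))))))))))) hP hle
      simp only [Nat.cast_ofNat, Int.cast_ofNat] at h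
      subst h
      exact hprinc _ hP0 _ (P211_209_eq_thirtyfour hθ)
    · exact absurd hprime (by norm_num)
    · exact absurd hprime (by norm_num)
    · exact absurd hprime (by norm_num)
    · exact absurd hprime (by norm_num)
    · exact absurd hprime (by norm_num)
    · exact absurd hprime (by norm_num)
    · exact absurd hprime (by norm_num)
    · exact absurd hprime (by norm_num)
  have hC : C ∈ H := by rw [htop]; exact Subgroup.mem_top C
  obtain ⟨y, hy, z, hz, rfl⟩ := Subgroup.mem_sup.mp hC
  obtain ⟨i, rfl⟩ := Subgroup.mem_zpowers_iff.mp hy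
  obtain ⟨j, rfl⟩ := Subgroup.mem_zpowers_iff.mp hz
  obtain ⟨r, s, h0r, hrα, h0s, hsγ, hrs⟩ :=
    cgPair_enum (by norm_num) (by norm_num) hrow1 hrow2 i j
  rw [hrs]
  have hr : r = 0 ∨ r = 1 := by omega
  have hs : s = 0 ∨ s = 1 ∨ s = 2 ∨ s = 3 ∨ s = 4 ∨ s = 5 := by omega
  clear h0r hrα h0s hsγ hrs
  rcases hr with rfl | rfl <;> rcases hs with rfl | rfl | rfl | rfl | rfl | rfl
  · refine Or.inl ?_
    rw [zpow_zero, zpow_zero, mul_one]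
  · refine Or.inr (Or.inl ?_)
    rw [cgPair_shift hrow1 hrow2 (0 : ℤ) (1 : ℤ) (0 : ℤ) (0 : ℤ)]
    rw [show (0 : ℤ) + 2 * 0 = (0 : ℤ) by norm_num, show (1 : ℤ) + 4 * 0 + 6 * 0 = (1 : ℤ) by norm_num]
    rw [zpow_zero, zpow_one, one_mul, ← hb]
  · refine Or.inr (Or.inr (Or.inl ?_))
    rw [cgPair_shift hrow1 hrow2 (0 : ℤ) (2 : ℤ) (1 : ℤ) (-1 : ℤ)]
    rw [show (0 : ℤ) + 2 * 1 = (2 : ℤ) by norm_num, show (2 : ℤ) + 4 * 1 + 6 * (-1) = (0 : ℤ) by norm_num]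
    rw [← ha, ← hb, ← cls_I3sq2_thirtyfour hθ]
  · refine Or.inr (Or.inr (Or.inr (Or.inl ?_)))
    rw [cgPair_shift hrow1 hrow2 (0 : ℤ) (3 : ℤ) (-1 : ℤ) (0 : ℤ)]
    rw [show (0 : ℤ) + 2 * (-1) = (-2 : ℤ) by norm_num, show (3 : ℤ) + 4 * (-1) + 6 * 0 = (-1 : ℤ) by norm_num]
    rw [← ha, ← hb, ← cls_P13_9_thirtyfour hθ]
  · refine Or.inr (Or.inr (Or.inr (Or.inr (Or.inl ?_))))
    rw [cgPair_shift hrow1 hrow2 (0 : ℤ) (4 : ℤ) (1 : ℤ) (-1 : ℤ)]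
    rw [show (0 : ℤ) + 2 * 1 = (2 : ℤ) by norm_num, show (4 : ℤ) + 4 * 1 + 6 * (-1) = (2 : ℤ) by norm_num]
    rw [← ha, ← hb, ← cls_P7_2_thirtyfour hθ]
  · refine Or.inr (Or.inr (Or.inr (Or.inr (Or.inr (Or.inl ?_)))))
    rw [cgPair_shift hrow1 hrow2 (0 : ℤ) (5 : ℤ) (0 : ℤ) (-1 : ℤ)]
    rw [show (0 : ℤ) + 2 * 0 = (0 : ℤ) by norm_num, show (5 : ℤ) + 4 * 0 + 6 * (-1) = (-1 : ℤ) by norm_num]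
    rw [← ha, ← hb, ← cls_P19_9_thirtyfour hθ]
  · refine Or.inr (Or.inr (Or.inr (Or.inr (Or.inr (Or.inr (Or.inl ?_))))))
    rw [cgPair_shift hrow1 hrow2 (1 : ℤ) (0 : ℤ) (0 : ℤ) (0 : ℤ)]
    rw [show (1 : ℤ) + 2 * 0 = (1 : ℤ) by norm_num, show (0 : ℤ) + 4 * 0 + 6 * 0 = (0 : ℤ) by norm_num]
    rw [zpow_one, zpow_zero, mul_one, ← ha]
  · refine Or.inr (Or.inr (Or.inr (Or.inr (Or.inr (Or.inr (Or.inr (Or.inl ?_)))))))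
    rw [cgPair_shift hrow1 hrow2 (1 : ℤ) (1 : ℤ) (0 : ℤ) (0 : ℤ)]
    rw [show (1 : ℤ) + 2 * 0 = (1 : ℤ) by norm_num, show (1 : ℤ) + 4 * 0 + 6 * 0 = (1 : ℤ) by norm_num]
    rw [← ha, ← hb, ← cls_P19_15_thirtyfour hθ]
  · refine Or.inr (Or.inr (Or.inr (Or.inr (Or.inr (Or.inr (Or.inr (Or.inr (Or.inl ?_))))))))
    rw [cgPair_shift hrow1 hrow2 (1 : ℤ) (2 : ℤ) (1 : ℤ) (-1 : ℤ)]
    rw [show (1 : ℤ) + 2 * 1 = (3 : ℤ) by norm_num, show (2 : ℤ) + 4 * 1 + 6 * (-1) = (0 : ℤ) by norm_num]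
    rw [← ha, ← hb, ← cls_I27_20_thirtyfour hθ]
  · refine Or.inr (Or.inr (Or.inr (Or.inr (Or.inr (Or.inr (Or.inr (Or.inr (Or.inr (Or.inl ?_)))))))))
    rw [cgPair_shift hrow1 hrow2 (1 : ℤ) (3 : ℤ) (-1 : ℤ) (0 : ℤ)]
    rw [show (1 : ℤ) + 2 * (-1) = (-1 : ℤ) by norm_num, show (3 : ℤ) + 4 * (-1) + 6 * 0 = (-1 : ℤ) by norm_num]
    rw [← ha, ← hb, ← cls_P17_5_thirtyfour hθ]
  · refine Or.inr (Or.inr (Or.inr (Or.inr (Or.inr (Or.inr (Or.inr (Or.inr (Or.inr (Or.inr (Or.inl ?_))))))))))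
    rw [cgPair_shift hrow1 hrow2 (1 : ℤ) (4 : ℤ) (-1 : ℤ) (0 : ℤ)]
    rw [show (1 : ℤ) + 2 * (-1) = (-1 : ℤ) by norm_num, show (4 : ℤ) + 4 * (-1) + 6 * 0 = (0 : ℤ) by norm_num]
    rw [← ha, ← hb, ← cls_P19_10_thirtyfour hθ]
  · refine Or.inr (Or.inr (Or.inr (Or.inr (Or.inr (Or.inr (Or.inr (Or.inr (Or.inr (Or.inr (Or.inr ?_))))))))))
    rw [cgPair_shift hrow1 hrow2 (1 : ℤ) (5 : ℤ) (-1 : ℤ) (0 : ℤ)]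
    rw [show (1 : ℤ) + 2 * (-1) = (-1 : ℤ) by norm_num, show (5 : ℤ) + 4 * (-1) + 6 * 0 = (1 : ℤ) by norm_num]
    rw [← ha, ← hb, ← cls_P41_26_thirtyfour hθ]


end Field


/-! ### The ideal classes of `ℤ[X]/(f₃₄)` and Gompf's conjecture for the traces `34` and `-29` -/

section Matrices

set_option maxHeartbeats 1000000 in
/-- **The ideal classes of `ℤ[Θ₃₄] = ℤ[X]/(f₃₄)`**: every non-zero ideal is in the class of one of
`⟨Θ - 1, 1⟩`, `⟨Θ - 5, 11⟩`, `⟨Θ - 2, 9⟩`, `⟨Θ - 9, 13⟩`, `⟨Θ - 2, 7⟩`, `⟨Θ - 9, 19⟩`, `⟨Θ - 2, 3⟩`, `⟨Θ - 15, 19⟩`, `⟨Θ - 20, 27⟩`, `⟨Θ - 5, 17⟩`, `⟨Θ - 10, 19⟩`, `⟨Θ - 26, 41⟩` (these representatives cover `C(ℤ[Θ₃₄])`). [cite: KimYamada2023, §6.1 (proof of Thm. B)] -/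
theorem ideal_class_adjoinRoot_thirtyfour (J : Ideal (AdjoinRoot (csPoly 34))) (hJ : J ≠ ⊥) :
    ∃ x y : AdjoinRoot (csPoly 34), x ≠ 0 ∧ y ≠ 0 ∧
      (span {x} * J = span {y} * csIdeal 1 1 34 ∨ span {x} * J = span {y} * csIdeal 5 11 34 ∨ span {x} * J = span {y} * csIdeal 2 9 34 ∨ span {x} * J = span {y} * csIdeal 9 13 34 ∨ span {x} * J = span {y} * csIdeal 2 7 34 ∨ span {x} * J = span {y} * csIdeal 9 19 34 ∨ span {x} * J = span {y} * csIdeal 2 3 34 ∨ span {x} * J = span {y} * csIdeal 15 19 34 ∨ span {x} * J = span {y} * csIdeal 20 27 34 ∨ span {x} * J = span {y} * csIdeal 5 17 34 ∨ span {x} * J = span {y} * csIdeal 10 19 34 ∨ span {x} * J = span {y} * csIdeal 26 41 34) := by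
  classical
  set θ' := AdjoinRoot.root (csPolyQ 34) with hθ'
  have hθ : aeval θ' (csPoly 34) = 0 := aeval_root_csPoly 34
  have h3 : finrank ℚ (CSField 34) = 3 := finrank_CSField 34
  obtain ⟨e, he⟩ := exists_ringEquiv_adjoinRoot_of_isUnit hθ h3 (isUnit_indexDet_thirtyfour hθ h3)
  set I : Ideal (𝓞 (CSField 34)) := J.map e with hI
  have hIJ : I.map (e.symm : 𝓞 (CSField 34) →+* AdjoinRoot (csPoly 34)) = J := by
    rw [hI]
    exact Ideal.map_of_equiv e (I := J)
  have hI0 : I ≠ ⊥ := by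
    intro h0
    apply hJ
    rw [← hIJ, h0, Ideal.map_bot]
  have hImem : I ∈ (Ideal (𝓞 (CSField 34)))⁰ := mem_nonZeroDivisors_iff_ne_zero.mpr hI0
  have hsymm : ∀ x, (e.symm : 𝓞 (CSField 34) →+* AdjoinRoot (csPoly 34)) (e x) = x :=
    fun x => e.symm_apply_apply x
  have hP11_5 : (span {(11 : 𝓞 (CSField 34)), thetaInt hθ - 5}).map
      (e.symm : 𝓞 (CSField 34) →+* AdjoinRoot (csPoly 34)) = csIdeal 5 11 34 := by
    rw [Ideal.map_span, Set.image_insert_eq, Set.image_singleton, map_sub, ← he, hsymm, map_ofNat,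
      map_ofNat, csIdeal, Set.pair_comm]
    simp
  have hI3sq2 : (span {(9 : 𝓞 (CSField 34)), thetaInt hθ - 2}).map
      (e.symm : 𝓞 (CSField 34) →+* AdjoinRoot (csPoly 34)) = csIdeal 2 9 34 := by
    rw [Ideal.map_span, Set.image_insert_eq, Set.image_singleton, map_sub, ← he, hsymm, map_ofNat,
      map_ofNat, csIdeal, Set.pair_comm]
    simp
  have hP13_9 : (span {(13 : 𝓞 (CSField 34)), thetaInt hθ - 9}).map
      (e.symm : 𝓞 (CSField 34) →+* AdjoinRoot (csPoly 34)) = csIdeal 9 13 34 := by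
    rw [Ideal.map_span, Set.image_insert_eq, Set.image_singleton, map_sub, ← he, hsymm, map_ofNat,
      map_ofNat, csIdeal, Set.pair_comm]
    simp
  have hP7_2 : (span {(7 : 𝓞 (CSField 34)), thetaInt hθ - 2}).map
      (e.symm : 𝓞 (CSField 34) →+* AdjoinRoot (csPoly 34)) = csIdeal 2 7 34 := by
    rw [Ideal.map_span, Set.image_insert_eq, Set.image_singleton, map_sub, ← he, hsymm, map_ofNat,
      map_ofNat, csIdeal, Set.pair_comm]
    simp
  have hP19_9 : (span {(19 : 𝓞 (CSField 34)), thetaInt hθ - 9}).map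
      (e.symm : 𝓞 (CSField 34) →+* AdjoinRoot (csPoly 34)) = csIdeal 9 19 34 := by
    rw [Ideal.map_span, Set.image_insert_eq, Set.image_singleton, map_sub, ← he, hsymm, map_ofNat,
      map_ofNat, csIdeal, Set.pair_comm]
    simp
  have hP3_2 : (span {(3 : 𝓞 (CSField 34)), thetaInt hθ - 2}).map
      (e.symm : 𝓞 (CSField 34) →+* AdjoinRoot (csPoly 34)) = csIdeal 2 3 34 := by
    rw [Ideal.map_span, Set.image_insert_eq, Set.image_singleton, map_sub, ← he, hsymm, map_ofNat,
      map_ofNat, csIdeal, Set.pair_comm]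
    simp
  have hP19_15 : (span {(19 : 𝓞 (CSField 34)), thetaInt hθ - 15}).map
      (e.symm : 𝓞 (CSField 34) →+* AdjoinRoot (csPoly 34)) = csIdeal 15 19 34 := by
    rw [Ideal.map_span, Set.image_insert_eq, Set.image_singleton, map_sub, ← he, hsymm, map_ofNat,
      map_ofNat, csIdeal, Set.pair_comm]
    simp
  have hI27_20 : (span {(27 : 𝓞 (CSField 34)), thetaInt hθ - 20}).map
      (e.symm : 𝓞 (CSField 34) →+* AdjoinRoot (csPoly 34)) = csIdeal 20 27 34 := by
    rw [Ideal.map_span, Set.image_insert_eq, Set.image_singleton, map_sub, ← he, hsymm, map_ofNat,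
      map_ofNat, csIdeal, Set.pair_comm]
    simp
  have hP17_5 : (span {(17 : 𝓞 (CSField 34)), thetaInt hθ - 5}).map
      (e.symm : 𝓞 (CSField 34) →+* AdjoinRoot (csPoly 34)) = csIdeal 5 17 34 := by
    rw [Ideal.map_span, Set.image_insert_eq, Set.image_singleton, map_sub, ← he, hsymm, map_ofNat,
      map_ofNat, csIdeal, Set.pair_comm]
    simp
  have hP19_10 : (span {(19 : 𝓞 (CSField 34)), thetaInt hθ - 10}).map
      (e.symm : 𝓞 (CSField 34) →+* AdjoinRoot (csPoly 34)) = csIdeal 10 19 34 := by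
    rw [Ideal.map_span, Set.image_insert_eq, Set.image_singleton, map_sub, ← he, hsymm, map_ofNat,
      map_ofNat, csIdeal, Set.pair_comm]
    simp
  have hP41_26 : (span {(41 : 𝓞 (CSField 34)), thetaInt hθ - 26}).map
      (e.symm : 𝓞 (CSField 34) →+* AdjoinRoot (csPoly 34)) = csIdeal 26 41 34 := by
    rw [Ideal.map_span, Set.image_insert_eq, Set.image_singleton, map_sub, ← he, hsymm, map_ofNat,
      map_ofNat, csIdeal, Set.pair_comm]
    simp
  have hcase : ∀ (P : Ideal (𝓞 (CSField 34))) (hP0 : P ∈ (Ideal (𝓞 (CSField 34)))⁰)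
      (Q : Ideal (AdjoinRoot (csPoly 34))),
      P.map (e.symm : 𝓞 (CSField 34) →+* AdjoinRoot (csPoly 34)) = Q →
      ClassGroup.mk0 ⟨I, hImem⟩ = ClassGroup.mk0 ⟨P, hP0⟩ →
        ∃ x y : AdjoinRoot (csPoly 34), x ≠ 0 ∧ y ≠ 0 ∧ span {x} * J = span {y} * Q := by
    intro P hP0 Q hPQ hcls
    obtain ⟨x, y, hx, hy, hxy⟩ := ClassGroup.mk0_eq_mk0_iff.mp hcls
    refine ⟨(e.symm : 𝓞 (CSField 34) →+* AdjoinRoot (csPoly 34)) x,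
      (e.symm : 𝓞 (CSField 34) →+* AdjoinRoot (csPoly 34)) y,
      (map_ne_zero_iff _ e.symm.injective).mpr hx, (map_ne_zero_iff _ e.symm.injective).mpr hy, ?_⟩
    have h := congrArg (Ideal.map (e.symm : 𝓞 (CSField 34) →+* AdjoinRoot (csPoly 34))) hxy
    simp only [Ideal.map_mul, Ideal.map_span, Set.image_singleton] at h
    rw [hIJ, hPQ] at h
    exact h
  rcases classGroup_mem_thirtyfour hθ h3 (ClassGroup.mk0 ⟨I, hImem⟩) with h1 | hcl | hcl | hcl | hcl | hcl | hcl | hcl | hcl | hcl | hcl | hcl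
  · obtain ⟨z, hz⟩ := ((ClassGroup.mk0_eq_one_iff hImem).mp h1).principal
    have hz' : I = span {z} := by rw [hz, submodule_span_eq]
    have hz0 : z ≠ 0 := by
      rintro rfl
      apply hI0
      rw [hz', Ideal.span_singleton_eq_bot]
    refine ⟨1, (e.symm : 𝓞 (CSField 34) →+* AdjoinRoot (csPoly 34)) z, one_ne_zero,
      (map_ne_zero_iff _ e.symm.injective).mpr hz0, Or.inl ?_⟩
    rw [Ideal.span_singleton_one, Ideal.top_mul, csIdeal_one_one, Ideal.mul_top, ← hIJ, hz',
      Ideal.map_span, Set.image_singleton]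
  · obtain ⟨x, y, hx, hy, h⟩ := hcase _ _ _ hP11_5 hcl
    exact ⟨x, y, hx, hy, Or.inr (Or.inl h)⟩
  · obtain ⟨x, y, hx, hy, h⟩ := hcase _ _ _ hI3sq2 hcl
    exact ⟨x, y, hx, hy, Or.inr (Or.inr (Or.inl h))⟩
  · obtain ⟨x, y, hx, hy, h⟩ := hcase _ _ _ hP13_9 hcl
    exact ⟨x, y, hx, hy, Or.inr (Or.inr (Or.inr (Or.inl h)))⟩
  · obtain ⟨x, y, hx, hy, h⟩ := hcase _ _ _ hP7_2 hcl
    exact ⟨x, y, hx, hy, Or.inr (Or.inr (Or.inr (Or.inr (Or.inl h))))⟩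
  · obtain ⟨x, y, hx, hy, h⟩ := hcase _ _ _ hP19_9 hcl
    exact ⟨x, y, hx, hy, Or.inr (Or.inr (Or.inr (Or.inr (Or.inr (Or.inl h)))))⟩
  · obtain ⟨x, y, hx, hy, h⟩ := hcase _ _ _ hP3_2 hcl
    exact ⟨x, y, hx, hy, Or.inr (Or.inr (Or.inr (Or.inr (Or.inr (Or.inr (Or.inl h))))))⟩
  · obtain ⟨x, y, hx, hy, h⟩ := hcase _ _ _ hP19_15 hcl
    exact ⟨x, y, hx, hy, Or.inr (Or.inr (Or.inr (Or.inr (Or.inr (Or.inr (Or.inr (Or.inl h)))))))⟩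
  · obtain ⟨x, y, hx, hy, h⟩ := hcase _ _ _ hI27_20 hcl
    exact ⟨x, y, hx, hy, Or.inr (Or.inr (Or.inr (Or.inr (Or.inr (Or.inr (Or.inr (Or.inr (Or.inl h))))))))⟩
  · obtain ⟨x, y, hx, hy, h⟩ := hcase _ _ _ hP17_5 hcl
    exact ⟨x, y, hx, hy, Or.inr (Or.inr (Or.inr (Or.inr (Or.inr (Or.inr (Or.inr (Or.inr (Or.inr (Or.inl h)))))))))⟩
  · obtain ⟨x, y, hx, hy, h⟩ := hcase _ _ _ hP19_10 hcl
    exact ⟨x, y, hx, hy, Or.inr (Or.inr (Or.inr (Or.inr (Or.inr (Or.inr (Or.inr (Or.inr (Or.inr (Or.inr (Or.inl h))))))))))⟩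
  · obtain ⟨x, y, hx, hy, h⟩ := hcase _ _ _ hP41_26 hcl
    exact ⟨x, y, hx, hy, Or.inr (Or.inr (Or.inr (Or.inr (Or.inr (Or.inr (Or.inr (Or.inr (Or.inr (Or.inr (Or.inr (h)))))))))))⟩

/-- `11 ∣ f₃₄(5)`: `(5, 11, 34) ∈ 𝒞𝒮`. [cite: KimYamada2023, §6.1 (proof of Thm. B)] -/
theorem rep0_dvd_eval_csPoly_thirtyfour : (11 : ℤ) ∣ (csPoly 34).eval 5 := by
  rw [eval_csPoly]; norm_num

/-- `9 ∣ f₃₄(2)`: `(2, 9, 34) ∈ 𝒞𝒮`. [cite: KimYamada2023, §6.1 (proof of Thm. B)] -/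
theorem rep1_dvd_eval_csPoly_thirtyfour : (9 : ℤ) ∣ (csPoly 34).eval 2 := by
  rw [eval_csPoly]; norm_num

/-- `13 ∣ f₃₄(9)`: `(9, 13, 34) ∈ 𝒞𝒮`. [cite: KimYamada2023, §6.1 (proof of Thm. B)] -/
theorem rep2_dvd_eval_csPoly_thirtyfour : (13 : ℤ) ∣ (csPoly 34).eval 9 := by
  rw [eval_csPoly]; norm_num

/-- `7 ∣ f₃₄(2)`: `(2, 7, 34) ∈ 𝒞𝒮`. [cite: KimYamada2023, §6.1 (proof of Thm. B)] -/
theorem rep3_dvd_eval_csPoly_thirtyfour : (7 : ℤ) ∣ (csPoly 34).eval 2 := by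
  rw [eval_csPoly]; norm_num

/-- `19 ∣ f₃₄(9)`: `(9, 19, 34) ∈ 𝒞𝒮`. [cite: KimYamada2023, §6.1 (proof of Thm. B)] -/
theorem rep4_dvd_eval_csPoly_thirtyfour : (19 : ℤ) ∣ (csPoly 34).eval 9 := by
  rw [eval_csPoly]; norm_num

/-- `3 ∣ f₃₄(2)`: `(2, 3, 34) ∈ 𝒞𝒮`. [cite: KimYamada2023, §6.1 (proof of Thm. B)] -/
theorem rep5_dvd_eval_csPoly_thirtyfour : (3 : ℤ) ∣ (csPoly 34).eval 2 := by
  rw [eval_csPoly]; norm_num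

/-- `19 ∣ f₃₄(15)`: `(15, 19, 34) ∈ 𝒞𝒮`. [cite: KimYamada2023, §6.1 (proof of Thm. B)] -/
theorem rep6_dvd_eval_csPoly_thirtyfour : (19 : ℤ) ∣ (csPoly 34).eval 15 := by
  rw [eval_csPoly]; norm_num

/-- `27 ∣ f₃₄(20)`: `(20, 27, 34) ∈ 𝒞𝒮`. [cite: KimYamada2023, §6.1 (proof of Thm. B)] -/
theorem rep7_dvd_eval_csPoly_thirtyfour : (27 : ℤ) ∣ (csPoly 34).eval 20 := by
  rw [eval_csPoly]; norm_num

/-- `17 ∣ f₃₄(5)`: `(5, 17, 34) ∈ 𝒞𝒮`. [cite: KimYamada2023, §6.1 (proof of Thm. B)] -/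
theorem rep8_dvd_eval_csPoly_thirtyfour : (17 : ℤ) ∣ (csPoly 34).eval 5 := by
  rw [eval_csPoly]; norm_num

/-- `19 ∣ f₃₄(10)`: `(10, 19, 34) ∈ 𝒞𝒮`. [cite: KimYamada2023, §6.1 (proof of Thm. B)] -/
theorem rep9_dvd_eval_csPoly_thirtyfour : (19 : ℤ) ∣ (csPoly 34).eval 10 := by
  rw [eval_csPoly]; norm_num

/-- `41 ∣ f₃₄(26)`: `(26, 41, 34) ∈ 𝒞𝒮`. [cite: KimYamada2023, §6.1 (proof of Thm. B)] -/
theorem rep10_dvd_eval_csPoly_thirtyfour : (41 : ℤ) ∣ (csPoly 34).eval 26 := by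
  rw [eval_csPoly]; norm_num

/-- **Every Cappell–Shaneson matrix of trace `34` is similar to one of 12 standard matrices**
(Prop. 2.14). [cite: KimYamada2023, §6.1 (proof of Thm. B) and Prop. 2.14] -/
theorem isConj_standardCSMatrix_of_trace_eq_thirtyfour (A : SL(3, ℤ))
    (hdet : ((A : Matrix (Fin 3) (Fin 3) ℤ) - 1).det = 1)
    (htr : Matrix.trace (A : Matrix (Fin 3) (Fin 3) ℤ) = 34) :
    IsConj A (standardCSMatrix 1 1 34 (one_dvd _)) ∨
      IsConj A (standardCSMatrix 5 11 34 rep0_dvd_eval_csPoly_thirtyfour) ∨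
      IsConj A (standardCSMatrix 2 9 34 rep1_dvd_eval_csPoly_thirtyfour) ∨
      IsConj A (standardCSMatrix 9 13 34 rep2_dvd_eval_csPoly_thirtyfour) ∨
      IsConj A (standardCSMatrix 2 7 34 rep3_dvd_eval_csPoly_thirtyfour) ∨
      IsConj A (standardCSMatrix 9 19 34 rep4_dvd_eval_csPoly_thirtyfour) ∨
      IsConj A (standardCSMatrix 2 3 34 rep5_dvd_eval_csPoly_thirtyfour) ∨
      IsConj A (standardCSMatrix 15 19 34 rep6_dvd_eval_csPoly_thirtyfour) ∨
      IsConj A (standardCSMatrix 20 27 34 rep7_dvd_eval_csPoly_thirtyfour) ∨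
      IsConj A (standardCSMatrix 5 17 34 rep8_dvd_eval_csPoly_thirtyfour) ∨
      IsConj A (standardCSMatrix 10 19 34 rep9_dvd_eval_csPoly_thirtyfour) ∨
      IsConj A (standardCSMatrix 26 41 34 rep10_dvd_eval_csPoly_thirtyfour) := by
  have hcover : ∀ J : Ideal (AdjoinRoot (csPoly 34)), J ≠ ⊥ →
      ∃ (c d : ℤ) (_ : d ∣ (csPoly 34).eval c) (x y : AdjoinRoot (csPoly 34)),
        x ≠ 0 ∧ y ≠ 0 ∧ Ideal.span {x} * J = Ideal.span {y} * csIdeal c d 34 ∧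
          ((c = 1 ∧ d = 1) ∨ (c = 5 ∧ d = 11) ∨ (c = 2 ∧ d = 9) ∨ (c = 9 ∧ d = 13) ∨ (c = 2 ∧ d = 7) ∨ (c = 9 ∧ d = 19) ∨ (c = 2 ∧ d = 3) ∨ (c = 15 ∧ d = 19) ∨ (c = 20 ∧ d = 27) ∨ (c = 5 ∧ d = 17) ∨ (c = 10 ∧ d = 19) ∨ (c = 26 ∧ d = 41)) := by
    intro J hJ
    obtain ⟨x, y, hx, hy, hxy⟩ := ideal_class_adjoinRoot_thirtyfour J hJ
    rcases hxy with h0 | h1 | h2 | h3 | h4 | h5 | h6 | h7 | h8 | h9 | h10 | h11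
    · exact ⟨1, 1, one_dvd _, x, y, hx, hy, h0, Or.inl ⟨rfl, rfl⟩⟩
    · exact ⟨5, 11, rep0_dvd_eval_csPoly_thirtyfour, x, y, hx, hy, h1, Or.inr (Or.inl ⟨rfl, rfl⟩)⟩
    · exact ⟨2, 9, rep1_dvd_eval_csPoly_thirtyfour, x, y, hx, hy, h2, Or.inr (Or.inr (Or.inl ⟨rfl, rfl⟩))⟩
    · exact ⟨9, 13, rep2_dvd_eval_csPoly_thirtyfour, x, y, hx, hy, h3, Or.inr (Or.inr (Or.inr (Or.inl ⟨rfl, rfl⟩)))⟩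
    · exact ⟨2, 7, rep3_dvd_eval_csPoly_thirtyfour, x, y, hx, hy, h4, Or.inr (Or.inr (Or.inr (Or.inr (Or.inl ⟨rfl, rfl⟩))))⟩
    · exact ⟨9, 19, rep4_dvd_eval_csPoly_thirtyfour, x, y, hx, hy, h5, Or.inr (Or.inr (Or.inr (Or.inr (Or.inr (Or.inl ⟨rfl, rfl⟩)))))⟩
    · exact ⟨2, 3, rep5_dvd_eval_csPoly_thirtyfour, x, y, hx, hy, h6, Or.inr (Or.inr (Or.inr (Or.inr (Or.inr (Or.inr (Or.inl ⟨rfl, rfl⟩))))))⟩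
    · exact ⟨15, 19, rep6_dvd_eval_csPoly_thirtyfour, x, y, hx, hy, h7, Or.inr (Or.inr (Or.inr (Or.inr (Or.inr (Or.inr (Or.inr (Or.inl ⟨rfl, rfl⟩)))))))⟩
    · exact ⟨20, 27, rep7_dvd_eval_csPoly_thirtyfour, x, y, hx, hy, h8, Or.inr (Or.inr (Or.inr (Or.inr (Or.inr (Or.inr (Or.inr (Or.inr (Or.inl ⟨rfl, rfl⟩))))))))⟩
    · exact ⟨5, 17, rep8_dvd_eval_csPoly_thirtyfour, x, y, hx, hy, h9, Or.inr (Or.inr (Or.inr (Or.inr (Or.inr (Or.inr (Or.inr (Or.inr (Or.inr (Or.inl ⟨rfl, rfl⟩)))))))))⟩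
    · exact ⟨10, 19, rep9_dvd_eval_csPoly_thirtyfour, x, y, hx, hy, h10, Or.inr (Or.inr (Or.inr (Or.inr (Or.inr (Or.inr (Or.inr (Or.inr (Or.inr (Or.inr (Or.inl ⟨rfl, rfl⟩))))))))))⟩
    · exact ⟨26, 41, rep10_dvd_eval_csPoly_thirtyfour, x, y, hx, hy, h11, Or.inr (Or.inr (Or.inr (Or.inr (Or.inr (Or.inr (Or.inr (Or.inr (Or.inr (Or.inr (Or.inr (⟨rfl, rfl⟩)))))))))))⟩
  obtain ⟨c, d, h, hconj, hcd⟩ := exists_isConj_standardCSMatrix_of_cover _ hcover A hdet htr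
  rcases hcd with ⟨rfl, rfl⟩ | ⟨rfl, rfl⟩ | ⟨rfl, rfl⟩ | ⟨rfl, rfl⟩ | ⟨rfl, rfl⟩ | ⟨rfl, rfl⟩ | ⟨rfl, rfl⟩ | ⟨rfl, rfl⟩ | ⟨rfl, rfl⟩ | ⟨rfl, rfl⟩ | ⟨rfl, rfl⟩ | ⟨rfl, rfl⟩
  · exact Or.inl hconj
  · exact Or.inr (Or.inl hconj)
  · exact Or.inr (Or.inr (Or.inl hconj))
  · exact Or.inr (Or.inr (Or.inr (Or.inl hconj)))
  · exact Or.inr (Or.inr (Or.inr (Or.inr (Or.inl hconj))))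
  · exact Or.inr (Or.inr (Or.inr (Or.inr (Or.inr (Or.inl hconj)))))
  · exact Or.inr (Or.inr (Or.inr (Or.inr (Or.inr (Or.inr (Or.inl hconj))))))
  · exact Or.inr (Or.inr (Or.inr (Or.inr (Or.inr (Or.inr (Or.inr (Or.inl hconj)))))))
  · exact Or.inr (Or.inr (Or.inr (Or.inr (Or.inr (Or.inr (Or.inr (Or.inr (Or.inl hconj))))))))
  · exact Or.inr (Or.inr (Or.inr (Or.inr (Or.inr (Or.inr (Or.inr (Or.inr (Or.inr (Or.inl hconj)))))))))
  · exact Or.inr (Or.inr (Or.inr (Or.inr (Or.inr (Or.inr (Or.inr (Or.inr (Or.inr (Or.inr (Or.inl hconj))))))))))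
  · exact Or.inr (Or.inr (Or.inr (Or.inr (Or.inr (Or.inr (Or.inr (Or.inr (Or.inr (Or.inr (Or.inr (hconj)))))))))))

/-- **Kim–Yamada 2023, Theorem B for the trace `34`, PROVED**: the non-trivial classes move by
Gompf moves to the traces `1` (from `(5, 11, 34)`), `-2` (from `(2, 9, 34)`), `-5` (from `(9, 13, 34)`), `-1` (from `(2, 7, 34)`), `-4` (from `(9, 19, 34)`), `1` (from `(2, 3, 34)`), `-4` (from `(15, 19, 34)`), `7` (from `(20, 27, 34)`), `0` (from `(5, 17, 34)`), `-4` (from `(10, 19, 34)`), `-7` (from `(26, 41, 34)`), where Gompf's conjecture holds. [cite: KimYamada2023, Thm. B, Lemma 6.1 and §6.1] -/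
theorem gompfConjectureForTrace_thirtyfour : GompfConjectureForTrace 34 := by
  intro A hdet htr
  rcases isConj_standardCSMatrix_of_trace_eq_thirtyfour A hdet htr with h0 | h1 | h2 | h3 | h4 | h5 | h6 | h7 | h8 | h9 | h10 | h11
  · exact (GompfEquiv.of_isConj h0).trans (gompfEquiv_standardCSMatrix_one_one 32 (one_dvd _))
  · exact (GompfEquiv.of_isConj h1).trans
      (gompfEquiv_standardCSMatrix_akbulutKirbyMatrix_of_modEq
        (gompfConjectureForTrace_of_mem_Icc_neg_seven_twelve (by norm_num)) rep0_dvd_eval_csPoly_thirtyfour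
        (show (34 : ℤ) ≡ 1 [ZMOD 11] by decide))
  · exact (GompfEquiv.of_isConj h2).trans
      (gompfEquiv_standardCSMatrix_akbulutKirbyMatrix_of_modEq
        (gompfConjectureForTrace_of_mem_Icc_neg_seven_twelve (by norm_num)) rep1_dvd_eval_csPoly_thirtyfour
        (show (34 : ℤ) ≡ -2 [ZMOD 9] by decide))
  · exact (GompfEquiv.of_isConj h3).trans
      (gompfEquiv_standardCSMatrix_akbulutKirbyMatrix_of_modEq
        (gompfConjectureForTrace_of_mem_Icc_neg_seven_twelve (by norm_num)) rep2_dvd_eval_csPoly_thirtyfour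
        (show (34 : ℤ) ≡ -5 [ZMOD 13] by decide))
  · exact (GompfEquiv.of_isConj h4).trans
      (gompfEquiv_standardCSMatrix_akbulutKirbyMatrix_of_modEq
        (gompfConjectureForTrace_of_mem_Icc_neg_seven_twelve (by norm_num)) rep3_dvd_eval_csPoly_thirtyfour
        (show (34 : ℤ) ≡ -1 [ZMOD 7] by decide))
  · exact (GompfEquiv.of_isConj h5).trans
      (gompfEquiv_standardCSMatrix_akbulutKirbyMatrix_of_modEq
        (gompfConjectureForTrace_of_mem_Icc_neg_seven_twelve (by norm_num)) rep4_dvd_eval_csPoly_thirtyfour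
        (show (34 : ℤ) ≡ -4 [ZMOD 19] by decide))
  · exact (GompfEquiv.of_isConj h6).trans
      (gompfEquiv_standardCSMatrix_akbulutKirbyMatrix_of_modEq
        (gompfConjectureForTrace_of_mem_Icc_neg_seven_twelve (by norm_num)) rep5_dvd_eval_csPoly_thirtyfour
        (show (34 : ℤ) ≡ 1 [ZMOD 3] by decide))
  · exact (GompfEquiv.of_isConj h7).trans
      (gompfEquiv_standardCSMatrix_akbulutKirbyMatrix_of_modEq
        (gompfConjectureForTrace_of_mem_Icc_neg_seven_twelve (by norm_num)) rep6_dvd_eval_csPoly_thirtyfour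
        (show (34 : ℤ) ≡ -4 [ZMOD 19] by decide))
  · exact (GompfEquiv.of_isConj h8).trans
      (gompfEquiv_standardCSMatrix_akbulutKirbyMatrix_of_modEq
        (gompfConjectureForTrace_of_mem_Icc_neg_seven_twelve (by norm_num)) rep7_dvd_eval_csPoly_thirtyfour
        (show (34 : ℤ) ≡ 7 [ZMOD 27] by decide))
  · exact (GompfEquiv.of_isConj h9).trans
      (gompfEquiv_standardCSMatrix_akbulutKirbyMatrix_of_modEq
        (gompfConjectureForTrace_of_mem_Icc_neg_seven_twelve (by norm_num)) rep8_dvd_eval_csPoly_thirtyfour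
        (show (34 : ℤ) ≡ 0 [ZMOD 17] by decide))
  · exact (GompfEquiv.of_isConj h10).trans
      (gompfEquiv_standardCSMatrix_akbulutKirbyMatrix_of_modEq
        (gompfConjectureForTrace_of_mem_Icc_neg_seven_twelve (by norm_num)) rep9_dvd_eval_csPoly_thirtyfour
        (show (34 : ℤ) ≡ -4 [ZMOD 19] by decide))
  · exact (GompfEquiv.of_isConj h11).trans
      (gompfEquiv_standardCSMatrix_akbulutKirbyMatrix_of_modEq
        (gompfConjectureForTrace_of_mem_Icc_neg_seven_twelve (by norm_num)) rep10_dvd_eval_csPoly_thirtyfour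
        (show (34 : ℤ) ≡ -7 [ZMOD 41] by decide))

/-- **Theorem B for the trace `-29`** (`= 5 - 34`), by Theorem A. [cite: KimYamada2023, Thm. A and Thm. B] -/
theorem gompfConjectureForTrace_neg_twentynine : GompfConjectureForTrace (-29) := by
  have h := gompfConjectureForTrace_of_five_sub gompfConjectureForTrace_thirtyfour
  norm_num at h
  exact h

end Matrices


end Literature.Topology.FourManifolds

end
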